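import Literature.Geometry.Kaehler.ComplexTorusEndomorphismFieldEigenspaces
import HarnessLib

/-!
# The factors of a complete family of `2 × 2` matrix units in `End_ℚ(X) ⊗ ℂ` ARE the complex embeddings of a central
# number field `K ⊆ End_ℚ(X)` with `[K:ℚ]` factors: `ε_w = e w 0 0 + e w 1 1` is the spectral projector of `K` at
# `σ_w`, `w ↦ σ_w` is a bijection onto `Hom(K, ℂ)`, and every factor has the same size `rank ε_w = 2g/[K:ℚ]`
# (Milne 1999 §2: «`E ⊗_ℚ k^al = ∏_{σ : F → k^al} E ⊗_{F,σ} k^al`», «`V_i = e_i V` … has dimension `2g/f` over `F_i`»)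

Layer `Literature/Geometry/Kaehler`, namespace `Literature.Geometry.Kaehler.ComplexTorus`; lane `lit-hodgefound`
(Track 2 foundations library), Layer A4 (Lefschetz groups), prover seat `lit-hodgefound-p17` (generation 62),
self-proposed rows g62-#6 and g62-#8 (§2–§4: projector-level dictionary, paired families, paired ranks) — the «`f` copies» uniformity left `-- TODO(general form)` by g61-#8 (type IV), g62-#2 (type II)
and g62-#4 (type III): there the unit families came from Lange's real structures `End_ℚ(X) ⊗ ℝ ≃ ∏_w M₂(ℝ)` ∕ `∏_w ℍ`,
whose indexing by the infinite places `w` of the centre carries no information about WHERE the centre goes; this file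
recovers it intrinsically.  BY NAME on p13's `ComplexTorusEndomorphismFieldEigenspaces` (Milne's Prop. 2.1 for
`k = ℂ`: `V_ℂ = ⊕_σ V_σ` with `dim V_σ · [K:ℚ] = #ι`, `finrank_iInf_eigenspace_toLin'_map_mul_finrank`); nothing of
`ComplexTorusLefschetzGroupMatrixUnitFamilyConnected` is needed (pure centre bookkeeping).  THEOREMS ONLY (no
definition, no instance, no notation, no named fact; D-0026, net debt 0).

## Sources, verbatim

* J. S. Milne, *Lefschetz classes on abelian varieties*, Duke Math. J. **96** (1999) 639–675 (held
  `paper:doi-10-1215-s0012-7094-99-09620-5`). §2, p. 646–647 (p0008–p0009): «Let `F ⊗_ℚ k = F¹ × ⋯ × Fᵗ` be the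
  decomposition of `F ⊗_ℚ k` into a product of fields […] `1 = e₁ + ⋯ + e_t` […] Then `V(A) = V₁ ⊕ ⋯ ⊕ V_t`,
  `V_i = e_i V = V ⊗_{F⊗k} F_i`. Proposition 2.1 below shows that `V_i` has dimension `2g/f` over `F_i`»;
  **Proposition 2.1**: «Let `A` be an abelian variety, and let `L` be a subfield of `End⁰(A)` containing the identity
  map. Then `V(A)` is a free `L ⊗_ℚ k`-module of rank `2 dim A/[L:ℚ]`»; p. 649–651: «`E ⊗_ℚ k^al ≈ ∏_{σ:F→k^al} E ⊗_{F,σ} k^al`»,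
  «`S(A)_{/k^al} = ∏_{σ:F→k^al} …`»; Summary p. 652: «The group `S(A)_{/k^al}` is isomorphic to `f` copies of the group
  listed in the second column» (`f = [F:ℚ]`).
* H. Lange, *Abelian Varieties over the Complex Numbers* (2023), §2.6.1 proof of the Proposition (the real structures
  `End_ℚ(X) ⊗ ℝ ≃ ∏_{ν=1}^{e} M₂(ℝ)`, `∏ ℍ`, `∏ M_d(ℂ)` over the `e` ∕ `e₀` infinite places of the centre).

## The argument (pure algebra in `M_ι(ℂ)`)

Let `f : K → M_ι(ℚ)` be a number field of CENTRAL endomorphisms (`f(K) ⊆ Z(End_ℚ(X))`) and `e w a b` (`w ∈ W`,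
`#W = [K:ℚ]`) a complete family of pairwise orthogonal `2 × 2` matrix-unit systems spanning `End_ℚ(X) ⊗ ℂ`.  Put
`ε_w = e w 0 0 + e w 1 1`, `k_ℂ = f(k) ⊗ 1`.  (1) `k_ℂ` commutes with every unit, and `e w 0 0 · x · e w 0 0 ∈ ℂ e w 0 0`
for every `x` in the span of the units; so `k_ℂ e w 0 0 = c₀ e w 0 0`, `k_ℂ e w 1 1 = c₁ e w 1 1`, and comparing on
`e w 1 0` gives `c₀ = c₁` (or `ε_w = 0`): **`k_ℂ ε_w = c_w(k) ε_w`**.  (2) Hence `ε_w V_ℂ ⊆ V_{c_w}` (simultaneous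
eigenvectors), and for `v ∈ V_σ` and `c_w ≠ σ`: `ε_w v = 0` (two different eigenvalues).  (3) `v = Σ_w ε_w v` and
`dim V_σ = #ι/[K:ℚ] ≥ 1` force every `σ` to be some `c_w`; counting (`#W = [K:ℚ] = #Hom(K,ℂ)`) makes `w ↦ c_w =: σ_w` a
BIJECTION onto the embeddings; then `ε_w V_ℂ = V_{σ_w}` exactly, `ε_w ≠ 0`, `rank ε_w · [K:ℚ] = #ι`, and
`rank e w 0 0 = rank e w 1 1 = ½ rank ε_w`.

## What is proved

* **`finrank_le_card_of_matrixUnitFamily_of_central`** — every embedding occurs: `[K:ℚ] ≤ #W` (steps (1)–(3)).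
* **`four_mul_card_le_finrank_of_matrixUnitFamily`** — conversely, if no factor vanishes (`e w 0 0 ≠ 0`) the
  `4 · #W` units are linearly independent inside `End_ℚ(X) ⊗ ℂ`, so `4 · #W ≤ dim_ℚ End_ℚ(X)`; for a quaternion
  algebra over `K` (`dim_ℚ End_ℚ(X) = 4[K:ℚ]`, Albert types II and III) this is `#W ≤ [K:ℚ]`.
* **`exists_equiv_embeddings_of_matrixUnitFamily_of_central`** — for `#W = [K:ℚ]`: the dictionary
  `c : W ≃ (K →+* ℂ)` with `k_ℂ · ε_w = (c w k) • ε_w`, `range ε_w = V_{c w} = ⨅_k ker(k_ℂ − (c w k))`, `e w 0 0 ≠ 0`,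
  `rank ε_w · [K:ℚ] = #ι`, `rank e w 0 0 = rank e w 1 1`, `2 · rank (e w 0 0) · [K:ℚ] = #ι` (uniform block sizes:
  Milne's «`f` copies» with `f = [K:ℚ]`, each factor on a space of dimension `2g/f`); and the same conclusion,
  together with `#W = [K:ℚ]`, from `e w 0 0 ≠ 0` and `dim_ℚ End_ℚ(X) ≤ 4[K:ℚ]` instead of `#W = [K:ℚ]`:
  **`exists_equiv_embeddings_of_matrixUnitFamily_of_central_of_finrank_le`** (the form met by the type III family of
  A4-88, indexed by `Fin n` with `n` a priori unknown: it yields `n = [K:ℚ] = f`).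
* §2 (g62-#8) the same dictionary at the level of the PROJECTORS alone, for families of any shape:
  **`finrank_le_card_of_centralIdempotents`**, **`exists_equiv_embeddings_of_centralIdempotents`** (`Σ_w ε_w = 1`,
  `k_ℂ ε_w = ε_w k_ℂ = c₀(w,k) ε_w`, `#W = [K:ℚ]` ⟹ `c : W ≃ Hom(K,ℂ)`, `ε_w V_ℂ = V_{c w}`, `rank ε_w · [K:ℚ] = #ι`,
  `ε_w ≠ 0`); §3 its instance for PAIRED `d × d` systems `e w s a b` (Albert type IV, `[K:ℚ] = 2 · #W`):
  **`exists_equiv_embeddings_of_matrixUnitPairFamily_of_central`** (`ε_{w,s} = Σ_a e w s a a`); §4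
  **`rank_sum_eq_of_mul_eq_mul_single_kronecker_submatrix`** (`X_a · P = P · (E_{aa} ⊗ Π_{w,s})` for `a < d` ⟹
  `rank (Σ_a X_a) = d · m_w`, through `Σ_a E_{aa} ⊗ D = 1 ⊗ D`) — the paired block size is a rank.
-/

open Module Matrix NumberField
open scoped Kronecker

namespace Literature.Geometry.Kaehler

namespace ComplexTorus

section CentreDictionary

variable {ι : Type*} [Fintype ι] [DecidableEq ι] {E : Type*} [NormedAddCommGroup E] [NormedSpace ℂ E]
  (Φ : (ι → ℝ) ≃L[ℝ] E) {K : Type*} [Field K] [NumberField K] (f : K →ₐ[ℚ] Matrix ι ι ℚ)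
  {W : Type*} [Fintype W] [DecidableEq W] {e : W → Fin 2 → Fin 2 → Matrix ι ι ℂ}

/-- The two elements of `Fin 2`. [folklore] -/
private theorem fin_two_eq_zero_or_one_cd (a : Fin 2) : a = 0 ∨ a = 1 := by
  fin_cases a
  · exact Or.inl rfl
  · exact Or.inr rfl

omit [DecidableEq ι] in
/-- A matrix commuting with a set of matrices commutes with their `ℂ`-span. [folklore] -/
private theorem mul_comm_of_mem_span_cd {M : Matrix ι ι ℂ} {s : Set (Matrix ι ι ℂ)} (h : ∀ x ∈ s, M * x = x * M)
    {φ : Matrix ι ι ℂ} (hφ : φ ∈ Submodule.span ℂ s) : M * φ = φ * M := by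
  induction hφ using Submodule.span_induction with
  | mem x hx => exact h x hx
  | zero => rw [mul_zero, zero_mul]
  | add x y _ _ hx hy => rw [mul_add, add_mul, hx, hy]
  | smul c x _ hx => rw [mul_smul_comm, smul_mul_assoc, hx]

omit [DecidableEq ι] [Fintype W] in
/-- **Corner sandwich**: for `x` in the span of the units, `e w a b · x · e w c d ∈ ℂ · e w a d` (the table
`e w a b · e w' a' b' · e w c d = δ δ δ e w a d`). [cite: Milne1999LefschetzClasses, §2 («`E ⊗_{F,σ} k^al ≈ M₂(k^al)`»)] -/
private theorem unit_mul_mul_unit_mem_span_singleton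
    (hmul : ∀ (w w' : W) (a b c d : Fin 2), e w a b * e w' c d = if w = w' ∧ b = c then e w a d else 0)
    {x : Matrix ι ι ℂ} (hx : x ∈ Submodule.span ℂ (Set.range fun p : W × Fin 2 × Fin 2 ↦ e p.1 p.2.1 p.2.2))
    (w : W) (a b c d : Fin 2) : e w a b * x * e w c d ∈ ℂ ∙ e w a d := by
  induction hx using Submodule.span_induction with
  | mem y hy =>
    obtain ⟨⟨w', a', b'⟩, rfl⟩ := hy
    dsimp only
    rw [hmul]
    split_ifs with h1
    · obtain ⟨rfl, rfl⟩ := h1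
      rw [hmul]
      split_ifs with h2
      · exact Submodule.mem_span_singleton_self _
      · exact Submodule.zero_mem _
    · rw [Matrix.zero_mul]
      exact Submodule.zero_mem _
  | zero =>
    rw [Matrix.mul_zero, Matrix.zero_mul]
    exact Submodule.zero_mem _
  | add y z _ _ hy hz =>
    rw [Matrix.mul_add, Matrix.add_mul]
    exact Submodule.add_mem _ hy hz
  | smul c y _ hy =>
    rw [Matrix.mul_smul, Matrix.smul_mul]
    exact Submodule.smul_mem _ c hy

omit [Fintype W] [DecidableEq W] in
/-- The centre commutes with the units (it commutes with `End_ℚ(X) ⊗ 1`, which spans them). [folklore] -/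
private theorem centre_mul_unit_comm (hfc : ∀ k, ∀ A ∈ endAlgRat Φ, f k * A = A * f k)
    (hspan : ∀ w a b,
      e w a b ∈ Submodule.span ℂ ((fun A : Matrix ι ι ℚ ↦ A.map (algebraMap ℚ ℂ)) '' (endAlgRat Φ : Set (Matrix ι ι ℚ))))
    (k : K) (w : W) (a b : Fin 2) : (f k).map (algebraMap ℚ ℂ) * e w a b = e w a b * (f k).map (algebraMap ℚ ℂ) := by
  refine mul_comm_of_mem_span_cd (fun x hx ↦ ?_) (hspan w a b)
  obtain ⟨A, hA, rfl⟩ := hx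
  rw [← Matrix.map_mul, hfc k A hA, Matrix.map_mul]

omit [Fintype W] in
/-- **Step (1): the centre acts on every factor by a scalar**, `k_ℂ · ε_w = c₀(w,k) • ε_w` (the centre of
`M₂(ℂ)` is the scalars; a vanishing factor gets an arbitrary scalar). [cite: Milne1999LefschetzClasses, §2 («`E_i = E ⊗_F F_i`», the centre `F ⊗ k = ∏ F_i` acting on the factors)] -/
private theorem exists_centre_smul (hfE : ∀ k, f k ∈ endAlgRat Φ) (hfc : ∀ k, ∀ A ∈ endAlgRat Φ, f k * A = A * f k)
    (hmul : ∀ (w w' : W) (a b c d : Fin 2), e w a b * e w' c d = if w = w' ∧ b = c then e w a d else 0)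
    (hspan : ∀ w a b,
      e w a b ∈ Submodule.span ℂ ((fun A : Matrix ι ι ℚ ↦ A.map (algebraMap ℚ ℂ)) '' (endAlgRat Φ : Set (Matrix ι ι ℚ))))
    (habs : ∀ A ∈ endAlgRat Φ,
      A.map (algebraMap ℚ ℂ) ∈ Submodule.span ℂ (Set.range fun p : W × Fin 2 × Fin 2 ↦ e p.1 p.2.1 p.2.2)) :
    ∃ c₀ : W → K → ℂ, ∀ w (k : K),
      (f k).map (algebraMap ℚ ℂ) * (e w 0 0 + e w 1 1) = c₀ w k • (e w 0 0 + e w 1 1) := by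
  have hcomm := centre_mul_unit_comm Φ f hfc hspan
  have ht : ∀ w (a b d : Fin 2), e w a b * e w b d = e w a d := fun w a b d ↦ by rw [hmul, if_pos ⟨rfl, rfl⟩]
  have hscalar : ∀ w (k : K), ∃ c : ℂ, (f k).map (algebraMap ℚ ℂ) * (e w 0 0 + e w 1 1) = c • (e w 0 0 + e w 1 1) := by
    intro w k
    have hk := habs (f k) (hfE k)
    obtain ⟨c₀, hc₀⟩ := Submodule.mem_span_singleton.1
      (unit_mul_mul_unit_mem_span_singleton hmul hk w 0 0 0 0)
    obtain ⟨c₁, hc₁⟩ := Submodule.mem_span_singleton.1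
      (unit_mul_mul_unit_mem_span_singleton hmul hk w 1 1 1 1)
    -- `k_ℂ e00 = c₀ e00`, `k_ℂ e11 = c₁ e11`
    have h0 : (f k).map (algebraMap ℚ ℂ) * e w 0 0 = c₀ • e w 0 0 := by
      rw [hc₀, ← hcomm, Matrix.mul_assoc, ht]
    have h1 : (f k).map (algebraMap ℚ ℂ) * e w 1 1 = c₁ • e w 1 1 := by
      rw [hc₁, ← hcomm, Matrix.mul_assoc, ht]
    -- comparing on `e10`: `c₁ e10 = k_ℂ e11 e10 = k_ℂ e10 = k_ℂ e10 e00 = e10 k_ℂ e00 = c₀ e10`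
    have h10 : c₁ • e w 1 0 = c₀ • e w 1 0 := by
      have ha : (f k).map (algebraMap ℚ ℂ) * e w 1 0 = c₁ • e w 1 0 := by
        calc (f k).map (algebraMap ℚ ℂ) * e w 1 0 = (f k).map (algebraMap ℚ ℂ) * (e w 1 1 * e w 1 0) := by rw [ht]
          _ = c₁ • e w 1 0 := by rw [← Matrix.mul_assoc, h1, Matrix.smul_mul, ht]
      have hb : (f k).map (algebraMap ℚ ℂ) * e w 1 0 = c₀ • e w 1 0 := by
        calc (f k).map (algebraMap ℚ ℂ) * e w 1 0 = (f k).map (algebraMap ℚ ℂ) * e w 1 0 * e w 0 0 := by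
              rw [Matrix.mul_assoc, ht]
          _ = e w 1 0 * ((f k).map (algebraMap ℚ ℂ) * e w 0 0) := by rw [hcomm, Matrix.mul_assoc]
          _ = c₀ • e w 1 0 := by rw [h0, Matrix.mul_smul, ht]
      rw [← ha, hb]
    by_cases h10z : e w 1 0 = 0
    · -- then the whole factor vanishes
      have h00z : e w 0 0 = 0 := by rw [← ht w 0 1 0, h10z, Matrix.mul_zero]
      have h11z : e w 1 1 = 0 := by rw [← ht w 1 0 1, h10z, Matrix.zero_mul]
      exact ⟨0, by rw [h00z, h11z, add_zero, Matrix.mul_zero, smul_zero]⟩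
    · have hc : c₁ = c₀ := by
        have h2 : (c₁ - c₀) • e w 1 0 = 0 := by rw [sub_smul, h10, sub_self]
        rcases smul_eq_zero.1 h2 with h3 | h3
        · exact sub_eq_zero.1 h3
        · exact absurd h3 h10z
      exact ⟨c₀, by rw [Matrix.mul_add, h0, h1, hc, smul_add]⟩
  choose c₀ hc₀ using hscalar
  exact ⟨c₀, hc₀⟩

omit [DecidableEq W] in
/-- **Steps (2)–(3): every embedding `σ` of `K` is the scalar character of some factor** (`V_σ ≠ 0` by Milne's
Prop. 2.1, `v = Σ_w ε_w v`, and `ε_w v = 0` whenever the factor's character differs from `σ`).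
[cite: Milne1999LefschetzClasses, §2 Prop. 2.1 and p. 646–647 («`V(A) = V₁ ⊕ ⋯ ⊕ V_t`, `V_i = e_i V`»)] -/
private theorem exists_index_of_embedding [Nonempty ι] (hfc : ∀ k, ∀ A ∈ endAlgRat Φ, f k * A = A * f k)
    (hone : ∑ w, (e w 0 0 + e w 1 1) = 1)
    (hspan : ∀ w a b,
      e w a b ∈ Submodule.span ℂ ((fun A : Matrix ι ι ℚ ↦ A.map (algebraMap ℚ ℂ)) '' (endAlgRat Φ : Set (Matrix ι ι ℚ))))
    {c₀ : W → K → ℂ}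
    (hc₀ : ∀ w (k : K), (f k).map (algebraMap ℚ ℂ) * (e w 0 0 + e w 1 1) = c₀ w k • (e w 0 0 + e w 1 1)) :
    (∀ (σ : K →+* ℂ) (v : ι → ℂ), (∀ k : K, (f k).map (algebraMap ℚ ℂ) *ᵥ v = σ k • v) →
        ∀ w, c₀ w ≠ ⇑σ → (e w 0 0 + e w 1 1) *ᵥ v = 0) ∧
      ∀ σ : K →+* ℂ, ∃ w, c₀ w = ⇑σ := by
  classical
  have hcomm := centre_mul_unit_comm Φ f hfc hspan
  have hcommε : ∀ (k : K) w, (f k).map (algebraMap ℚ ℂ) * (e w 0 0 + e w 1 1) =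
      (e w 0 0 + e w 1 1) * (f k).map (algebraMap ℚ ℂ) := fun k w ↦ by
    rw [Matrix.mul_add, Matrix.add_mul, hcomm, hcomm]
  have hεv : ∀ w (k : K) (v : ι → ℂ), (f k).map (algebraMap ℚ ℂ) *ᵥ ((e w 0 0 + e w 1 1) *ᵥ v) =
      c₀ w k • ((e w 0 0 + e w 1 1) *ᵥ v) := fun w k v ↦ by
    rw [Matrix.mulVec_mulVec, hc₀, Matrix.smul_mulVec]
  have hkill : ∀ (σ : K →+* ℂ) (v : ι → ℂ), (∀ k : K, (f k).map (algebraMap ℚ ℂ) *ᵥ v = σ k • v) →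
      ∀ w, c₀ w ≠ ⇑σ → (e w 0 0 + e w 1 1) *ᵥ v = 0 := by
    intro σ v hv w hne
    obtain ⟨k, hk⟩ := Function.ne_iff.1 hne
    have h1 : (f k).map (algebraMap ℚ ℂ) *ᵥ ((e w 0 0 + e w 1 1) *ᵥ v) = σ k • ((e w 0 0 + e w 1 1) *ᵥ v) := by
      rw [Matrix.mulVec_mulVec, hcommε, ← Matrix.mulVec_mulVec, hv, Matrix.mulVec_smul]
    have h2 : (c₀ w k - σ k) • ((e w 0 0 + e w 1 1) *ᵥ v) = 0 := by
      rw [sub_smul, ← hεv, h1, sub_self]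
    rcases smul_eq_zero.1 h2 with h3 | h3
    · exact absurd (sub_eq_zero.1 h3) hk
    · exact h3
  refine ⟨hkill, fun σ ↦ ?_⟩
  have hsumv : ∀ v : ι → ℂ, ∑ w, (e w 0 0 + e w 1 1) *ᵥ v = v := fun v ↦ by
    rw [← Matrix.sum_mulVec, hone, Matrix.one_mulVec]
  -- `V_σ ≠ 0` by Milne's Prop. 2.1
  have hVne : (⨅ k : K, Module.End.eigenspace (Matrix.toLin' ((f k).map (algebraMap ℚ ℂ))) (σ k)) ≠ ⊥ := by
    intro hbot
    have h := finrank_iInf_eigenspace_toLin'_map_mul_finrank f σ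
    rw [hbot, finrank_bot, zero_mul] at h
    exact Fintype.card_ne_zero h.symm
  by_contra hno
  simp only [not_exists] at hno
  refine hVne ((Submodule.eq_bot_iff _).2 fun v hv ↦ ?_)
  have hv' : ∀ k : K, (f k).map (algebraMap ℚ ℂ) *ᵥ v = σ k • v := by
    simpa only [Submodule.mem_iInf, Module.End.mem_eigenspace_iff, Matrix.toLin'_apply] using hv
  rw [← hsumv v]
  exact Finset.sum_eq_zero fun w _ ↦ hkill σ v hv' w (hno w)

/-- **EVERY COMPLEX EMBEDDING OF A CENTRAL NUMBER FIELD IS CARRIED BY SOME FACTOR: `[K:ℚ] ≤ #W`** — for a number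
field `f : K → Z(End_ℚ(X))` of central endomorphisms and a complete family of pairwise orthogonal `2 × 2` matrix-unit
systems lying in `End_ℚ(X) ⊗ ℂ` and spanning it («`E ⊗_ℚ k^al = ∏_{σ:F→k^al} E ⊗_{F,σ} k^al`»: at least one factor
per embedding). [cite: Milne1999LefschetzClasses, §2 p. 646–647, Prop. 2.1 and p. 649 («`E ⊗_ℚ k^al ≈ ∏_{σ} E ⊗_{F,σ} k^al`»)] -/
theorem finrank_le_card_of_matrixUnitFamily_of_central [Nonempty ι]
    (hfE : ∀ k, f k ∈ endAlgRat Φ) (hfc : ∀ k, ∀ A ∈ endAlgRat Φ, f k * A = A * f k)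
    (hmul : ∀ (w w' : W) (a b c d : Fin 2), e w a b * e w' c d = if w = w' ∧ b = c then e w a d else 0)
    (hone : ∑ w, (e w 0 0 + e w 1 1) = 1)
    (hspan : ∀ w a b,
      e w a b ∈ Submodule.span ℂ ((fun A : Matrix ι ι ℚ ↦ A.map (algebraMap ℚ ℂ)) '' (endAlgRat Φ : Set (Matrix ι ι ℚ))))
    (habs : ∀ A ∈ endAlgRat Φ,
      A.map (algebraMap ℚ ℂ) ∈ Submodule.span ℂ (Set.range fun p : W × Fin 2 × Fin 2 ↦ e p.1 p.2.1 p.2.2)) :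
    finrank ℚ K ≤ Fintype.card W := by
  classical
  obtain ⟨c₀, hc₀⟩ := exists_centre_smul Φ f hfE hfc hmul hspan habs
  obtain ⟨-, hsurj⟩ := exists_index_of_embedding Φ f hfc hone hspan hc₀
  choose g hg using hsurj
  have hginj : Function.Injective g := by
    intro σ τ h
    apply DFunLike.coe_injective
    rw [← hg σ, ← hg τ, h]
  rw [← Embeddings.card K ℂ]
  exact Fintype.card_le_of_injective g hginj

/-- **NO FACTOR VANISHES ⟹ `4 · #W ≤ dim_ℚ End_ℚ(X)`**: the `4 · #W` units `e w a b` are linearly independent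
(`e w 0 a · (Σ c e) · e w b 0 = c_{wab} e w 0 0`) inside `span_ℂ(End_ℚ(X) ⊗ 1)`, whose dimension is at most
`dim_ℚ End_ℚ(X)`; for a quaternion algebra over `K` (Albert types II and III: `dim_ℚ End_ℚ(X) = 4[K:ℚ]`) this reads
`#W ≤ [K:ℚ]` — at most one factor per embedding. [cite: Milne1999LefschetzClasses, §2 («`E ⊗_{F,σ} k^al ≈ M₂(k^al)`», p. 649–651)]
[cite: Lange2023AbelianVarietiesComplex, §2.6.1 proof of the Proposition («`End_ℚ(X) ⊗_ℚ ℝ ≃ ∏_{ν=1}^{e} M₂(ℝ)`» ∕ «`∏ ℍ`»)] -/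
theorem four_mul_card_le_finrank_of_matrixUnitFamily
    (hmul : ∀ (w w' : W) (a b c d : Fin 2), e w a b * e w' c d = if w = w' ∧ b = c then e w a d else 0)
    (hspan : ∀ w a b,
      e w a b ∈ Submodule.span ℂ ((fun A : Matrix ι ι ℚ ↦ A.map (algebraMap ℚ ℂ)) '' (endAlgRat Φ : Set (Matrix ι ι ℚ))))
    (hne : ∀ w, e w 0 0 ≠ 0) : 4 * Fintype.card W ≤ finrank ℚ (endAlgRat Φ) := by
  classical
  have ht : ∀ w (a b d : Fin 2), e w a b * e w b d = e w a d := fun w a b d ↦ by rw [hmul, if_pos ⟨rfl, rfl⟩]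
  -- the units are linearly independent
  have hli : LinearIndependent ℂ fun p : W × Fin 2 × Fin 2 ↦ e p.1 p.2.1 p.2.2 := by
    rw [Fintype.linearIndependent_iff]
    intro g hg ⟨w, a, b⟩
    have h := congrArg (fun X : Matrix ι ι ℂ ↦ e w 0 a * X * e w b 0) hg
    simp only [Matrix.mul_zero, Matrix.zero_mul, Finset.mul_sum, Finset.sum_mul] at h
    rw [Finset.sum_eq_single (w, a, b)] at h
    · rw [Matrix.mul_smul, Matrix.smul_mul, ht, ht] at h
      rcases smul_eq_zero.1 h with h1 | h1
      · exact h1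
      · exact absurd h1 (hne w)
    · rintro ⟨w', a', b'⟩ - hne'
      rw [Matrix.mul_smul, Matrix.smul_mul, hmul]
      split_ifs with h1
      · obtain ⟨rfl, rfl⟩ := h1
        rw [hmul]
        split_ifs with h2
        · obtain ⟨-, rfl⟩ := h2
          exact absurd rfl hne'
        · rw [smul_zero]
      · rw [Matrix.zero_mul, smul_zero]
    · exact fun h ↦ (h (Finset.mem_univ _)).elim
  -- dimension of their span, inside `span_ℂ(End_ℚ(X) ⊗ 1)`, itself of dimension `≤ dim_ℚ End_ℚ(X)`
  have hcard : 4 * Fintype.card W = finrank ℂ (Submodule.span ℂ (Set.range fun p : W × Fin 2 × Fin 2 ↦ e p.1 p.2.1 p.2.2)) := by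
    rw [finrank_span_eq_card hli, Fintype.card_prod, Fintype.card_prod, Fintype.card_fin, mul_comm]
  have hle : Submodule.span ℂ (Set.range fun p : W × Fin 2 × Fin 2 ↦ e p.1 p.2.1 p.2.2) ≤
      Submodule.span ℂ ((fun A : Matrix ι ι ℚ ↦ A.map (algebraMap ℚ ℂ)) '' (endAlgRat Φ : Set (Matrix ι ι ℚ))) :=
    Submodule.span_le.2 (by rintro _ ⟨⟨w, a, b⟩, rfl⟩; exact hspan w a b)
  -- a `ℚ`-basis of `End_ℚ(X)` spans `End_ℚ(X) ⊗ 1` over `ℂ`, so the latter has dimension `≤ dim_ℚ End_ℚ(X)`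
  haveI : Module.Finite ℚ (endAlgRat Φ) :=
    Module.Finite.of_injective (endAlgRat Φ).val.toLinearMap Subtype.val_injective
  let bE := Module.finBasis ℚ (endAlgRat Φ)
  let φ : Matrix ι ι ℚ →ₐ[ℚ] Matrix ι ι ℂ := (Algebra.ofId ℚ ℂ).mapMatrix
  have hφ : ∀ A : Matrix ι ι ℚ, φ A = A.map (algebraMap ℚ ℂ) := fun A ↦ rfl
  have hspanE : Submodule.span ℂ ((fun A : Matrix ι ι ℚ ↦ A.map (algebraMap ℚ ℂ)) '' (endAlgRat Φ : Set (Matrix ι ι ℚ))) ≤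
      Submodule.span ℂ (Set.range fun j ↦ φ ((endAlgRat Φ).val (bE j))) := by
    refine Submodule.span_le.2 ?_
    rintro _ ⟨A, hA, rfl⟩
    have hA' : A = ∑ j, bE.repr ⟨A, hA⟩ j • (endAlgRat Φ).val (bE j) := by
      have h := congrArg ((endAlgRat Φ).val : endAlgRat Φ → Matrix ι ι ℚ) (bE.sum_repr ⟨A, hA⟩)
      rw [map_sum] at h
      simp only [map_smul] at h
      exact h.symm
    show A.map (algebraMap ℚ ℂ) ∈ _
    rw [← hφ, hA', map_sum]
    refine Submodule.sum_mem _ fun j _ ↦ ?_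
    rw [map_smul, ← algebraMap_smul ℂ (bE.repr ⟨A, hA⟩ j) (φ _)]
    exact Submodule.smul_mem _ _ (Submodule.subset_span ⟨j, rfl⟩)
  calc 4 * Fintype.card W
      = finrank ℂ (Submodule.span ℂ (Set.range fun p : W × Fin 2 × Fin 2 ↦ e p.1 p.2.1 p.2.2)) := hcard
    _ ≤ finrank ℂ (Submodule.span ℂ
          ((fun A : Matrix ι ι ℚ ↦ A.map (algebraMap ℚ ℂ)) '' (endAlgRat Φ : Set (Matrix ι ι ℚ)))) :=
        Submodule.finrank_mono hle
    _ ≤ finrank ℂ (Submodule.span ℂ (Set.range fun j ↦ φ ((endAlgRat Φ).val (bE j)))) := Submodule.finrank_mono hspanE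
    _ ≤ Fintype.card (Fin (finrank ℚ (endAlgRat Φ))) :=
        finrank_range_le_card (R := ℂ) fun j ↦ φ ((endAlgRat Φ).val (bE j))
    _ = finrank ℚ (endAlgRat Φ) := Fintype.card_fin _

/-- **Block sizes are ranks**: if `X · P = P · (E_{aa} ⊗ Π_w)` in a frame `P ∈ GL_ι(ℂ)` relabelled by
`eι : Fin 2 × Σ_w Fin (m w) ≃ ι` (`Π_w` the diagonal projector onto block `w`), then `rank X = m w` — the block size
of the adapted frame of `ComplexTorusLefschetzGroupMatrixUnitFamilyConnected` §2 is the rank of the corner idempotent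
`e w a a`. [folklore] [cite: Milne1999LefschetzClasses, §2 («`V_σ = V_{σ₁} ⊕ V_{σ₂}`, `V_{σ_i} = V ⊗_{L,σ_i} k^al`»)] -/
theorem rank_eq_of_mul_eq_mul_single_kronecker_submatrix {m : W → ℕ} (eι : (Fin 2 × Σ w, Fin (m w)) ≃ ι)
    {P X : Matrix ι ι ℂ} (hP : IsUnit P.det) (w : W) (a : Fin 2)
    (h : X * P = P * (Matrix.single a a (1 : ℂ) ⊗ₖ Matrix.diagonal
        fun p : Σ w, Fin (m w) ↦ if p.1 = w then (1 : ℂ) else 0).submatrix eι.symm eι.symm) :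
    X.rank = m w := by
  classical
  set Y : Matrix ι ι ℂ := (Matrix.single a a (1 : ℂ) ⊗ₖ Matrix.diagonal
    fun p : Σ w, Fin (m w) ↦ if p.1 = w then (1 : ℂ) else 0).submatrix eι.symm eι.symm with hY
  have hX : X = P * Y * P⁻¹ := by
    rw [← h, Matrix.mul_assoc, Matrix.mul_nonsing_inv _ hP, Matrix.mul_one]
  rw [hX, Matrix.rank_mul_eq_left_of_isUnit_det P⁻¹ (P * Y) (Matrix.isUnit_nonsing_inv_det P hP),
    Matrix.rank_mul_eq_right_of_isUnit_det P Y hP, hY, Matrix.rank_submatrix, ← Matrix.diagonal_single,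
    Matrix.diagonal_kronecker_diagonal, Matrix.rank_diagonal]
  -- count the non-zero diagonal entries: `q = (a, ⟨w, x⟩)`, `x : Fin (m w)`
  have hpred : ∀ q : Fin 2 × Σ w, Fin (m w),
      ((Pi.single a (1 : ℂ) : Fin 2 → ℂ) q.1 * (if q.2.1 = w then (1 : ℂ) else 0) ≠ 0) ↔
        (q.1 = a ∧ q.2.1 = w) := by
    intro q
    by_cases h1 : q.1 = a <;> by_cases h2 : q.2.1 = w <;> simp [h1, h2]
  let e₁ : {q : Fin 2 × Σ w, Fin (m w) // q.1 = a ∧ q.2.1 = w} ≃ {p : Σ w, Fin (m w) // p.1 = w} :=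
    { toFun := fun q ↦ ⟨q.1.2, q.2.2⟩
      invFun := fun p ↦ ⟨(a, p.1), rfl, p.2⟩
      left_inv := by
        rintro ⟨⟨c, p⟩, hc, hp⟩
        exact Subtype.ext (Prod.ext hc.symm rfl)
      right_inv := fun _ ↦ rfl }
  exact (Fintype.card_congr <| (Equiv.subtypeEquivRight hpred).trans
    (e₁.trans (Equiv.sigmaSubtype (β := fun w ↦ Fin (m w)) w))).trans (Fintype.card_fin _)

/-- **THE FACTORS OF A COMPLETE FAMILY OF `2 × 2` MATRIX UNITS ARE THE COMPLEX EMBEDDINGS OF A CENTRAL NUMBER FIELD.**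
Let `X = E/Φ(ℤ^ι)` be a complex torus (`ι ≠ ∅`), `f : K → M_ι(ℚ)` a number field of CENTRAL endomorphisms
(`f(K) ⊆ End_ℚ(X)`, `f(k)` commuting with `End_ℚ(X)`), and `e w a b ∈ M_ι(ℂ)` (`w ∈ W`, `#W = [K:ℚ]`, `a, b ∈ {0,1}`)
pairwise orthogonal `2 × 2` matrix-unit systems with `Σ_w (e w 0 0 + e w 1 1) = 1`, lying in `End_ℚ(X) ⊗ ℂ` and
spanning it.  Then there is a BIJECTION `c : W ≃ Hom(K, ℂ)` such that, with `ε_w = e w 0 0 + e w 1 1` and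
`k_ℂ = f(k) ⊗ 1`: `k_ℂ · ε_w = (c w)(k) · ε_w` (the centre acts on the `w`-th factor through the embedding `c w`);
`ε_w V_ℂ = V_{c w} = {v ∣ k_ℂ v = (c w)(k) v ∀ k}` (the `w`-th factor IS the `(c w)`-eigenspace of `K`, Milne's
`V_i = e_i V`); `e w 0 0 ≠ 0`; and the sizes are UNIFORM: `rank ε_w · [K:ℚ] = #ι`, `rank (e w 0 0) = rank (e w 1 1)`,
`2 · rank (e w 0 0) · [K:ℚ] = #ι` («`V_i` has dimension `2g/f` over `F_i`», «`f` copies of the group listed»).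
[cite: Milne1999LefschetzClasses, §2 p. 646–647 («`V_i = e_i V` … dimension `2g/f`»), Prop. 2.1, and Summary table (p. 652: «`f` copies»)]
[cite: Lange2023AbelianVarietiesComplex, §2.6.1 proof of the Proposition] -/
theorem exists_equiv_embeddings_of_matrixUnitFamily_of_central [Nonempty ι]
    (hfE : ∀ k, f k ∈ endAlgRat Φ) (hfc : ∀ k, ∀ A ∈ endAlgRat Φ, f k * A = A * f k)
    (hW : Fintype.card W = finrank ℚ K)
    (hmul : ∀ (w w' : W) (a b c d : Fin 2), e w a b * e w' c d = if w = w' ∧ b = c then e w a d else 0)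
    (hone : ∑ w, (e w 0 0 + e w 1 1) = 1)
    (hspan : ∀ w a b,
      e w a b ∈ Submodule.span ℂ ((fun A : Matrix ι ι ℚ ↦ A.map (algebraMap ℚ ℂ)) '' (endAlgRat Φ : Set (Matrix ι ι ℚ))))
    (habs : ∀ A ∈ endAlgRat Φ,
      A.map (algebraMap ℚ ℂ) ∈ Submodule.span ℂ (Set.range fun p : W × Fin 2 × Fin 2 ↦ e p.1 p.2.1 p.2.2)) :
    ∃ c : W ≃ (K →+* ℂ),
      (∀ w (k : K), (f k).map (algebraMap ℚ ℂ) * (e w 0 0 + e w 1 1) = (c w k) • (e w 0 0 + e w 1 1)) ∧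
      (∀ w, LinearMap.range (Matrix.toLin' (e w 0 0 + e w 1 1)) =
        ⨅ k : K, Module.End.eigenspace (Matrix.toLin' ((f k).map (algebraMap ℚ ℂ))) (c w k)) ∧
      (∀ w, e w 0 0 ≠ 0) ∧
      (∀ w, (e w 0 0 + e w 1 1).rank * finrank ℚ K = Fintype.card ι) ∧
      (∀ w, (e w 0 0).rank = (e w 1 1).rank) ∧
      (∀ w, 2 * (e w 0 0).rank * finrank ℚ K = Fintype.card ι) := by
  classical
  have ht : ∀ w (a b d : Fin 2), e w a b * e w b d = e w a d := fun w a b d ↦ by rw [hmul, if_pos ⟨rfl, rfl⟩]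
  have ht' : ∀ w (a b c d : Fin 2), b ≠ c → e w a b * e w c d = 0 := fun w a b c d h ↦ by
    rw [hmul, if_neg fun H ↦ h H.2]
  have hεe : ∀ w (a b : Fin 2), (e w 0 0 + e w 1 1) * e w a b = e w a b := by
    intro w a b
    rw [Matrix.add_mul]
    rcases fin_two_eq_zero_or_one_cd a with rfl | rfl
    · rw [ht, ht' w 1 1 0 b one_ne_zero, add_zero]
    · rw [ht' w 0 0 1 b zero_ne_one, ht, zero_add]
  -- (1)–(3) scalars, and every embedding occurs
  obtain ⟨c₀, hc₀⟩ := exists_centre_smul Φ f hfE hfc hmul hspan habs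
  obtain ⟨hkill, hsurj⟩ := exists_index_of_embedding Φ f hfc hone hspan hc₀
  have hεv : ∀ w (k : K) (v : ι → ℂ), (f k).map (algebraMap ℚ ℂ) *ᵥ ((e w 0 0 + e w 1 1) *ᵥ v) =
      c₀ w k • ((e w 0 0 + e w 1 1) *ᵥ v) := fun w k v ↦ by
    rw [Matrix.mulVec_mulVec, hc₀, Matrix.smul_mulVec]
  have hmemV : ∀ (σ : K →+* ℂ) (v : ι → ℂ),
      v ∈ (⨅ k : K, Module.End.eigenspace (Matrix.toLin' ((f k).map (algebraMap ℚ ℂ))) (σ k)) ↔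
        ∀ k : K, (f k).map (algebraMap ℚ ℂ) *ᵥ v = σ k • v := fun σ v ↦ by
    simp only [Submodule.mem_iInf, Module.End.mem_eigenspace_iff, Matrix.toLin'_apply]
  have hsumv : ∀ v : ι → ℂ, ∑ w, (e w 0 0 + e w 1 1) *ᵥ v = v := fun v ↦ by
    rw [← Matrix.sum_mulVec, hone, Matrix.one_mulVec]
  -- counting: `w ↦ c₀ w` is a bijection onto the embeddings
  choose g hg using hsurj
  have hginj : Function.Injective g := by
    intro σ τ h
    apply DFunLike.coe_injective
    rw [← hg σ, ← hg τ, h]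
  have hgbij : Function.Bijective g := by
    rw [Fintype.bijective_iff_injective_and_card]
    exact ⟨hginj, by rw [hW, Embeddings.card]⟩
  obtain ⟨c, hc'⟩ : ∃ c : W ≃ (K →+* ℂ), ∀ w, g (c w) = w :=
    ⟨(Equiv.ofBijective g hgbij).symm, fun w ↦ Equiv.ofBijective_apply_symm_apply g hgbij w⟩
  have hc : ∀ w, c₀ w = ⇑(c w) := fun w ↦ by
    have h1 := hg (c w)
    rwa [hc' w] at h1
  have hcinj : ∀ w w', w ≠ w' → c₀ w' ≠ ⇑(c w) := by
    intro w w' hne h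
    have h1 : c w' = c w := DFunLike.coe_injective ((hc w').symm.trans h)
    exact hne (c.injective h1).symm
  -- (4) the range of `ε_w` is the `(c w)`-eigenspace
  have hrange : ∀ w, LinearMap.range (Matrix.toLin' (e w 0 0 + e w 1 1)) =
      ⨅ k : K, Module.End.eigenspace (Matrix.toLin' ((f k).map (algebraMap ℚ ℂ))) (c w k) := by
    intro w
    apply le_antisymm
    · rintro _ ⟨v, rfl⟩
      rw [hmemV]
      intro k
      rw [Matrix.toLin'_apply, hεv, hc]
    · intro v hv
      rw [hmemV] at hv
      refine ⟨v, ?_⟩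
      rw [Matrix.toLin'_apply]
      conv_rhs => rw [← hsumv v]
      rw [Finset.sum_eq_single w (fun w' _ hw' ↦ hkill (c w) v hv w' (hcinj w w' (Ne.symm hw'))) fun h ↦
        (h (Finset.mem_univ w)).elim]
  -- (5) non-vanishing and ranks
  have hrankε : ∀ w, (e w 0 0 + e w 1 1).rank * finrank ℚ K = Fintype.card ι := by
    intro w
    rw [show (e w 0 0 + e w 1 1).rank = finrank ℂ (LinearMap.range (e w 0 0 + e w 1 1).mulVecLin) from rfl,
      ← Matrix.toLin'_apply', hrange]
    exact finrank_iInf_eigenspace_toLin'_map_mul_finrank f (c w)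
  have hne : ∀ w, e w 0 0 ≠ 0 := by
    intro w h00
    have h10 : e w 1 0 = 0 := by rw [← ht w 1 0 0, h00, Matrix.mul_zero]
    have h11 : e w 1 1 = 0 := by rw [← ht w 1 0 1, h10, Matrix.zero_mul]
    have h := hrankε w
    rw [h00, h11, add_zero, Matrix.rank_zero, zero_mul] at h
    exact Fintype.card_ne_zero h.symm
  have hrank01 : ∀ w, (e w 0 0).rank = (e w 1 1).rank := by
    intro w
    apply le_antisymm
    · calc (e w 0 0).rank = (e w 0 1 * e w 1 1 * e w 1 0).rank := by rw [ht, ht]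
        _ ≤ (e w 0 1 * e w 1 1).rank := Matrix.rank_mul_le_left _ _
        _ ≤ (e w 1 1).rank := Matrix.rank_mul_le_right _ _
    · calc (e w 1 1).rank = (e w 1 0 * e w 0 0 * e w 0 1).rank := by rw [ht, ht]
        _ ≤ (e w 1 0 * e w 0 0).rank := Matrix.rank_mul_le_left _ _
        _ ≤ (e w 0 0).rank := Matrix.rank_mul_le_right _ _
  -- `rank ε_w = rank e00 + rank e11`: the two ranges are complementary inside `range ε_w`
  have hranksum : ∀ w, (e w 0 0 + e w 1 1).rank = (e w 0 0).rank + (e w 1 1).rank := by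
    intro w
    have hsup : LinearMap.range (e w 0 0 + e w 1 1).mulVecLin =
        LinearMap.range (e w 0 0).mulVecLin ⊔ LinearMap.range (e w 1 1).mulVecLin := by
      apply le_antisymm
      · rintro _ ⟨v, rfl⟩
        rw [Matrix.mulVecLin_apply, Matrix.add_mulVec]
        exact Submodule.add_mem_sup ⟨v, rfl⟩ ⟨v, rfl⟩
      · refine sup_le ?_ ?_
        · rintro _ ⟨v, rfl⟩
          refine ⟨e w 0 0 *ᵥ v, ?_⟩
          rw [Matrix.mulVecLin_apply, Matrix.mulVecLin_apply, Matrix.mulVec_mulVec, hεe]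
        · rintro _ ⟨v, rfl⟩
          refine ⟨e w 1 1 *ᵥ v, ?_⟩
          rw [Matrix.mulVecLin_apply, Matrix.mulVecLin_apply, Matrix.mulVec_mulVec, hεe]
    have hinf : LinearMap.range (e w 0 0).mulVecLin ⊓ LinearMap.range (e w 1 1).mulVecLin = ⊥ := by
      rw [Submodule.eq_bot_iff]
      rintro x ⟨⟨u, hu⟩, ⟨u', hu'⟩⟩
      rw [Matrix.mulVecLin_apply] at hu hu'
      have h1 : e w 0 0 *ᵥ x = x := by rw [← hu, Matrix.mulVec_mulVec, ht]
      have h2 : e w 0 0 *ᵥ x = 0 := by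
        rw [← hu', Matrix.mulVec_mulVec, ht' w 0 0 1 1 zero_ne_one, Matrix.zero_mulVec]
      rw [← h1, h2]
    have h := Submodule.finrank_sup_add_finrank_inf_eq (LinearMap.range (e w 0 0).mulVecLin)
      (LinearMap.range (e w 1 1).mulVecLin)
    rw [← hsup, hinf, finrank_bot, add_zero] at h
    exact h
  refine ⟨c, fun w k ↦ by rw [hc₀, hc], hrange, hne, hrankε, hrank01, fun w ↦ ?_⟩
  have h1 : (e w 0 0 + e w 1 1).rank = 2 * (e w 0 0).rank := by rw [hranksum, ← hrank01, two_mul]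
  rw [← h1]
  exact hrankε w

/-- **The same dictionary from `e w 0 0 ≠ 0` and `dim_ℚ End_ℚ(X) ≤ 4[K:ℚ]` instead of `#W = [K:ℚ]`** — the form met
by a unit family indexed by an a-priori unknown `Fin n` (A4-88's type III family) over a torus whose `End_ℚ(X)` is
a quaternion algebra over the central field `K` (Albert types II and III): it yields `n = #W = [K:ℚ] = f` first
(`[K:ℚ] ≤ #W` because every embedding occurs, `4 · #W ≤ dim_ℚ End_ℚ(X) ≤ 4[K:ℚ]` by independence of the units).
[cite: Milne1999LefschetzClasses, §2 p. 649–651 («`E ⊗_ℚ k^al ≈ ∏_{σ:F→k^al} E ⊗_{F,σ} k^al`») and Summary table (p. 652: «`f` copies»)]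
[cite: Lange2023AbelianVarietiesComplex, §2.6.1 proof of the Proposition] -/
theorem exists_equiv_embeddings_of_matrixUnitFamily_of_central_of_finrank_le [Nonempty ι]
    (hfE : ∀ k, f k ∈ endAlgRat Φ) (hfc : ∀ k, ∀ A ∈ endAlgRat Φ, f k * A = A * f k)
    (hdim : finrank ℚ (endAlgRat Φ) ≤ 4 * finrank ℚ K) (hne : ∀ w, e w 0 0 ≠ 0)
    (hmul : ∀ (w w' : W) (a b c d : Fin 2), e w a b * e w' c d = if w = w' ∧ b = c then e w a d else 0)
    (hone : ∑ w, (e w 0 0 + e w 1 1) = 1)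
    (hspan : ∀ w a b,
      e w a b ∈ Submodule.span ℂ ((fun A : Matrix ι ι ℚ ↦ A.map (algebraMap ℚ ℂ)) '' (endAlgRat Φ : Set (Matrix ι ι ℚ))))
    (habs : ∀ A ∈ endAlgRat Φ,
      A.map (algebraMap ℚ ℂ) ∈ Submodule.span ℂ (Set.range fun p : W × Fin 2 × Fin 2 ↦ e p.1 p.2.1 p.2.2)) :
    Fintype.card W = finrank ℚ K ∧
    ∃ c : W ≃ (K →+* ℂ),
      (∀ w (k : K), (f k).map (algebraMap ℚ ℂ) * (e w 0 0 + e w 1 1) = (c w k) • (e w 0 0 + e w 1 1)) ∧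
      (∀ w, LinearMap.range (Matrix.toLin' (e w 0 0 + e w 1 1)) =
        ⨅ k : K, Module.End.eigenspace (Matrix.toLin' ((f k).map (algebraMap ℚ ℂ))) (c w k)) ∧
      (∀ w, (e w 0 0 + e w 1 1).rank * finrank ℚ K = Fintype.card ι) ∧
      (∀ w, (e w 0 0).rank = (e w 1 1).rank) ∧
      (∀ w, 2 * (e w 0 0).rank * finrank ℚ K = Fintype.card ι) := by
  have h4 := four_mul_card_le_finrank_of_matrixUnitFamily Φ hmul hspan hne
  have hW : Fintype.card W = finrank ℚ K :=
    le_antisymm (by omega) (finrank_le_card_of_matrixUnitFamily_of_central Φ f hfE hfc hmul hone hspan habs)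
  obtain ⟨c, h1, h2, -, h3, h5, h6⟩ :=
    exists_equiv_embeddings_of_matrixUnitFamily_of_central Φ f hfE hfc hW hmul hone hspan habs
  exact ⟨hW, c, h1, h2, h3, h5, h6⟩

end CentreDictionary

/-! ## §2 The dictionary at the level of the central idempotents alone

Steps (2)–(3) and the count use only the complete family of commuting projectors `ε_w` on which the centre acts by
scalars (Milne's `1 = e₁ + ⋯ + e_t`, `V_i = e_i V`); they are recorded here for families of ANY shape — below for the
paired `d × d` systems of Albert type IV. -/

section CentralIdempotents

variable {ι : Type*} [Fintype ι] [DecidableEq ι] {K : Type*} [Field K] [NumberField K] (f : K →ₐ[ℚ] Matrix ι ι ℚ)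
  {W : Type*} [Fintype W] {ε : W → Matrix ι ι ℂ}

/-- Steps (2)–(3) for a bare complete family of projectors `ε_w` (`Σ_w ε_w = 1`) commuting with the field and on
which it acts by scalars `c₀ w`: `ε_w` kills `V_σ` unless `c₀ w = σ`, and every `σ` is some `c₀ w` (`V_σ ≠ 0`).
[cite: Milne1999LefschetzClasses, §2 Prop. 2.1 and p. 646–647 («`1 = e₁ + ⋯ + e_t`», «`V(A) = V₁ ⊕ ⋯ ⊕ V_t`, `V_i = e_i V`»)] -/
private theorem exists_index_of_embedding_ci [Nonempty ι] (hone : ∑ w, ε w = 1)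
    (hcomm : ∀ (k : K) w, (f k).map (algebraMap ℚ ℂ) * ε w = ε w * (f k).map (algebraMap ℚ ℂ))
    {c₀ : W → K → ℂ} (hc₀ : ∀ w (k : K), (f k).map (algebraMap ℚ ℂ) * ε w = c₀ w k • ε w) :
    (∀ (σ : K →+* ℂ) (v : ι → ℂ), (∀ k : K, (f k).map (algebraMap ℚ ℂ) *ᵥ v = σ k • v) →
        ∀ w, c₀ w ≠ ⇑σ → ε w *ᵥ v = 0) ∧
      ∀ σ : K →+* ℂ, ∃ w, c₀ w = ⇑σ := by
  classical
  have hεv : ∀ w (k : K) (v : ι → ℂ), (f k).map (algebraMap ℚ ℂ) *ᵥ (ε w *ᵥ v) = c₀ w k • (ε w *ᵥ v) :=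
    fun w k v ↦ by rw [Matrix.mulVec_mulVec, hc₀, Matrix.smul_mulVec]
  have hkill : ∀ (σ : K →+* ℂ) (v : ι → ℂ), (∀ k : K, (f k).map (algebraMap ℚ ℂ) *ᵥ v = σ k • v) →
      ∀ w, c₀ w ≠ ⇑σ → ε w *ᵥ v = 0 := by
    intro σ v hv w hne
    obtain ⟨k, hk⟩ := Function.ne_iff.1 hne
    have h1 : (f k).map (algebraMap ℚ ℂ) *ᵥ (ε w *ᵥ v) = σ k • (ε w *ᵥ v) := by
      rw [Matrix.mulVec_mulVec, hcomm, ← Matrix.mulVec_mulVec, hv, Matrix.mulVec_smul]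
    have h2 : (c₀ w k - σ k) • (ε w *ᵥ v) = 0 := by
      rw [sub_smul, ← hεv, h1, sub_self]
    rcases smul_eq_zero.1 h2 with h3 | h3
    · exact absurd (sub_eq_zero.1 h3) hk
    · exact h3
  refine ⟨hkill, fun σ ↦ ?_⟩
  have hsumv : ∀ v : ι → ℂ, ∑ w, ε w *ᵥ v = v := fun v ↦ by
    rw [← Matrix.sum_mulVec, hone, Matrix.one_mulVec]
  -- `V_σ ≠ 0` by Milne's Prop. 2.1
  have hVne : (⨅ k : K, Module.End.eigenspace (Matrix.toLin' ((f k).map (algebraMap ℚ ℂ))) (σ k)) ≠ ⊥ := by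
    intro hbot
    have h := finrank_iInf_eigenspace_toLin'_map_mul_finrank f σ
    rw [hbot, finrank_bot, zero_mul] at h
    exact Fintype.card_ne_zero h.symm
  by_contra hno
  simp only [not_exists] at hno
  refine hVne ((Submodule.eq_bot_iff _).2 fun v hv ↦ ?_)
  have hv' : ∀ k : K, (f k).map (algebraMap ℚ ℂ) *ᵥ v = σ k • v := by
    simpa only [Submodule.mem_iInf, Module.End.mem_eigenspace_iff, Matrix.toLin'_apply] using hv
  rw [← hsumv v]
  exact Finset.sum_eq_zero fun w _ ↦ hkill σ v hv' w (hno w)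

/-- **EVERY COMPLEX EMBEDDING IS THE CHARACTER OF SOME PROJECTOR: `[K:ℚ] ≤ #W`**, for a number field
`f : K → M_ι(ℚ)` (`ι ≠ ∅`) and a complete family of projectors `ε_w ∈ M_ι(ℂ)` (`Σ_w ε_w = 1`) commuting with `f(K) ⊗ 1`
on which `K` acts by scalars («`V(A) = V₁ ⊕ ⋯ ⊕ V_t`, `V_i = e_i V`», each `V_σ ≠ 0` by Prop. 2.1).
[cite: Milne1999LefschetzClasses, §2 p. 646–647 and Prop. 2.1] -/
theorem finrank_le_card_of_centralIdempotents [Nonempty ι] (hone : ∑ w, ε w = 1)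
    (hcomm : ∀ (k : K) w, (f k).map (algebraMap ℚ ℂ) * ε w = ε w * (f k).map (algebraMap ℚ ℂ))
    {c₀ : W → K → ℂ} (hc₀ : ∀ w (k : K), (f k).map (algebraMap ℚ ℂ) * ε w = c₀ w k • ε w) :
    finrank ℚ K ≤ Fintype.card W := by
  classical
  obtain ⟨-, hsurj⟩ := exists_index_of_embedding_ci f hone hcomm hc₀
  choose g hg using hsurj
  have hginj : Function.Injective g := by
    intro σ τ h
    apply DFunLike.coe_injective
    rw [← hg σ, ← hg τ, h]
  calc finrank ℚ K = Fintype.card (K →+* ℂ) := (Embeddings.card K ℂ).symm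
    _ ≤ Fintype.card W := Fintype.card_le_of_injective g hginj

/-- **THE CENTRE DICTIONARY FOR A COMPLETE FAMILY OF PROJECTORS** (any shape): for a number field `f : K → M_ι(ℚ)`
(`ι ≠ ∅`) and projectors `ε_w ∈ M_ι(ℂ)`, `w ∈ W`, `#W = [K:ℚ]`, with `Σ_w ε_w = 1`, `k_ℂ ε_w = ε_w k_ℂ` and
`k_ℂ ε_w = c₀(w,k) ε_w`, there is a BIJECTION `c : W ≃ Hom(K, ℂ)` with `c₀ w = c w` (the character of the `w`-th
projector is the embedding `c w`), `ε_w V_ℂ = V_{c w}` (Milne's `V_i = e_i V`), `rank ε_w · [K:ℚ] = #ι` («dimension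
`2g/f`») and `ε_w ≠ 0`.
[cite: Milne1999LefschetzClasses, §2 p. 646–647 («`1 = e₁ + ⋯ + e_t`», «`V_i = e_i V` … dimension `2g/f`»), Prop. 2.1 and p. 649 («`E ⊗_ℚ k^al ≈ ∏_{σ:F→k^al} E ⊗_{F,σ} k^al`»)] -/
theorem exists_equiv_embeddings_of_centralIdempotents [Nonempty ι] (hW : Fintype.card W = finrank ℚ K)
    (hone : ∑ w, ε w = 1)
    (hcomm : ∀ (k : K) w, (f k).map (algebraMap ℚ ℂ) * ε w = ε w * (f k).map (algebraMap ℚ ℂ))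
    {c₀ : W → K → ℂ} (hc₀ : ∀ w (k : K), (f k).map (algebraMap ℚ ℂ) * ε w = c₀ w k • ε w) :
    ∃ c : W ≃ (K →+* ℂ), (∀ w, c₀ w = ⇑(c w)) ∧
      (∀ w, LinearMap.range (Matrix.toLin' (ε w)) =
        ⨅ k : K, Module.End.eigenspace (Matrix.toLin' ((f k).map (algebraMap ℚ ℂ))) (c w k)) ∧
      (∀ w, (ε w).rank * finrank ℚ K = Fintype.card ι) ∧ (∀ w, ε w ≠ 0) := by
  classical
  obtain ⟨hkill, hsurj⟩ := exists_index_of_embedding_ci f hone hcomm hc₀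
  have hεv : ∀ w (k : K) (v : ι → ℂ), (f k).map (algebraMap ℚ ℂ) *ᵥ (ε w *ᵥ v) = c₀ w k • (ε w *ᵥ v) :=
    fun w k v ↦ by rw [Matrix.mulVec_mulVec, hc₀, Matrix.smul_mulVec]
  have hmemV : ∀ (σ : K →+* ℂ) (v : ι → ℂ),
      v ∈ (⨅ k : K, Module.End.eigenspace (Matrix.toLin' ((f k).map (algebraMap ℚ ℂ))) (σ k)) ↔
        ∀ k : K, (f k).map (algebraMap ℚ ℂ) *ᵥ v = σ k • v := fun σ v ↦ by
    simp only [Submodule.mem_iInf, Module.End.mem_eigenspace_iff, Matrix.toLin'_apply]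
  have hsumv : ∀ v : ι → ℂ, ∑ w, ε w *ᵥ v = v := fun v ↦ by
    rw [← Matrix.sum_mulVec, hone, Matrix.one_mulVec]
  -- counting: `w ↦ c₀ w` is a bijection onto the embeddings
  choose g hg using hsurj
  have hginj : Function.Injective g := by
    intro σ τ h
    apply DFunLike.coe_injective
    rw [← hg σ, ← hg τ, h]
  have hgbij : Function.Bijective g := by
    rw [Fintype.bijective_iff_injective_and_card]
    exact ⟨hginj, by rw [hW, Embeddings.card]⟩
  obtain ⟨c, hc'⟩ : ∃ c : W ≃ (K →+* ℂ), ∀ w, g (c w) = w :=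
    ⟨(Equiv.ofBijective g hgbij).symm, fun w ↦ Equiv.ofBijective_apply_symm_apply g hgbij w⟩
  have hc : ∀ w, c₀ w = ⇑(c w) := fun w ↦ by
    have h1 := hg (c w)
    rwa [hc' w] at h1
  have hcinj : ∀ w w', w ≠ w' → c₀ w' ≠ ⇑(c w) := by
    intro w w' hne h
    have h1 : c w' = c w := DFunLike.coe_injective ((hc w').symm.trans h)
    exact hne (c.injective h1).symm
  -- the range of `ε_w` is the `(c w)`-eigenspace
  have hrange : ∀ w, LinearMap.range (Matrix.toLin' (ε w)) =
      ⨅ k : K, Module.End.eigenspace (Matrix.toLin' ((f k).map (algebraMap ℚ ℂ))) (c w k) := by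
    intro w
    apply le_antisymm
    · rintro _ ⟨v, rfl⟩
      rw [hmemV]
      intro k
      rw [Matrix.toLin'_apply, hεv, hc]
    · intro v hv
      rw [hmemV] at hv
      refine ⟨v, ?_⟩
      rw [Matrix.toLin'_apply]
      conv_rhs => rw [← hsumv v]
      rw [Finset.sum_eq_single w (fun w' _ hw' ↦ hkill (c w) v hv w' (hcinj w w' (Ne.symm hw'))) fun h ↦
        (h (Finset.mem_univ w)).elim]
  have hrankε : ∀ w, (ε w).rank * finrank ℚ K = Fintype.card ι := by
    intro w
    rw [show (ε w).rank = finrank ℂ (LinearMap.range (ε w).mulVecLin) from rfl, ← Matrix.toLin'_apply', hrange]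
    exact finrank_iInf_eigenspace_toLin'_map_mul_finrank f (c w)
  have hne : ∀ w, ε w ≠ 0 := by
    intro w h0
    have h := hrankε w
    rw [h0, Matrix.rank_zero, zero_mul] at h
    exact Fintype.card_ne_zero h.symm
  exact ⟨c, hc, hrange, hrankε, hne⟩

end CentralIdempotents

/-! ## §3 Paired `d × d` systems (the shape of Albert type IV): the `2 · #W = [K:ℚ]` projectors
`ε_{w,s} = Σ_a e w s a a` ARE the embeddings of the CM centre, and `rank ε_{w,s} · [K:ℚ] = #ι` -/

section CentreDictionaryPairs

variable {ι : Type*} [Fintype ι] [DecidableEq ι] {E : Type*} [NormedAddCommGroup E] [NormedSpace ℂ E]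
  (Φ : (ι → ℝ) ≃L[ℝ] E) {K : Type*} [Field K] [NumberField K] (f : K →ₐ[ℚ] Matrix ι ι ℚ)
  {W : Type*} [Fintype W] [DecidableEq W] {d : ℕ} {e : W → Fin 2 → Fin d → Fin d → Matrix ι ι ℂ}

omit [DecidableEq ι] [Fintype W] in
/-- **Corner sandwich, pair families**: for `x` in the span of the units, `e w s a b · x · e w s c d' ∈ ℂ · e w s a d'`.
[cite: Milne1999LefschetzClasses, §2 («`E ⊗_{F,σ} k^al ≈ M_d(k^al) × M_d(k^al)`»)] -/
private theorem unit_mul_mul_unit_mem_span_singleton_pair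
    (hmul : ∀ (w w' : W) (s s' : Fin 2) (a b c d' : Fin d),
      e w s a b * e w' s' c d' = if w = w' ∧ s = s' ∧ b = c then e w s a d' else 0)
    {x : Matrix ι ι ℂ}
    (hx : x ∈ Submodule.span ℂ (Set.range fun p : W × Fin 2 × Fin d × Fin d ↦ e p.1 p.2.1 p.2.2.1 p.2.2.2))
    (w : W) (s : Fin 2) (a b c d' : Fin d) : e w s a b * x * e w s c d' ∈ ℂ ∙ e w s a d' := by
  induction hx using Submodule.span_induction with
  | mem y hy =>
    obtain ⟨⟨w', s', a', b'⟩, rfl⟩ := hy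
    dsimp only
    rw [hmul]
    split_ifs with h1
    · obtain ⟨rfl, rfl, rfl⟩ := h1
      rw [hmul]
      split_ifs with h2
      · exact Submodule.mem_span_singleton_self _
      · exact Submodule.zero_mem _
    · rw [Matrix.zero_mul]
      exact Submodule.zero_mem _
  | zero =>
    rw [Matrix.mul_zero, Matrix.zero_mul]
    exact Submodule.zero_mem _
  | add y z _ _ hy hz =>
    rw [Matrix.mul_add, Matrix.add_mul]
    exact Submodule.add_mem _ hy hz
  | smul c y _ hy =>
    rw [Matrix.mul_smul, Matrix.smul_mul]
    exact Submodule.smul_mem _ c hy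

omit [Fintype W] [DecidableEq W] in
/-- The centre commutes with the pair units (it commutes with `End_ℚ(X) ⊗ 1`, which spans them). [folklore] -/
private theorem centre_mul_unit_comm_pair (hfc : ∀ k, ∀ A ∈ endAlgRat Φ, f k * A = A * f k)
    (hspan : ∀ w s a b,
      e w s a b ∈ Submodule.span ℂ ((fun A : Matrix ι ι ℚ ↦ A.map (algebraMap ℚ ℂ)) '' (endAlgRat Φ : Set (Matrix ι ι ℚ))))
    (k : K) (w : W) (s : Fin 2) (a b : Fin d) :
    (f k).map (algebraMap ℚ ℂ) * e w s a b = e w s a b * (f k).map (algebraMap ℚ ℂ) := by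
  refine mul_comm_of_mem_span_cd (fun x hx ↦ ?_) (hspan w s a b)
  obtain ⟨A, hA, rfl⟩ := hx
  rw [← Matrix.map_mul, hfc k A hA, Matrix.map_mul]

omit [Fintype W] in
/-- **Step (1), pair families: the centre acts on every projector `ε_{w,s} = Σ_a e w s a a` by a scalar** (each corner
`e w s a a` carries a scalar by the corner sandwich, and comparing on `e w s a 0` makes them equal — or the corner
vanishes). [cite: Milne1999LefschetzClasses, §2 p. 651 («`E ⊗_ℚ k^al = ∏_σ E_σ`», the centre `K ⊗ k^al = ∏ k_σ` acting on the factors)] -/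
private theorem exists_centre_smul_pair [NeZero d] (hfE : ∀ k, f k ∈ endAlgRat Φ)
    (hfc : ∀ k, ∀ A ∈ endAlgRat Φ, f k * A = A * f k)
    (hmul : ∀ (w w' : W) (s s' : Fin 2) (a b c d' : Fin d),
      e w s a b * e w' s' c d' = if w = w' ∧ s = s' ∧ b = c then e w s a d' else 0)
    (hspan : ∀ w s a b,
      e w s a b ∈ Submodule.span ℂ ((fun A : Matrix ι ι ℚ ↦ A.map (algebraMap ℚ ℂ)) '' (endAlgRat Φ : Set (Matrix ι ι ℚ))))
    (habs : ∀ A ∈ endAlgRat Φ, A.map (algebraMap ℚ ℂ) ∈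
      Submodule.span ℂ (Set.range fun p : W × Fin 2 × Fin d × Fin d ↦ e p.1 p.2.1 p.2.2.1 p.2.2.2)) :
    ∃ c₀ : W × Fin 2 → K → ℂ, ∀ w s (k : K),
      (f k).map (algebraMap ℚ ℂ) * ∑ a, e w s a a = c₀ (w, s) k • ∑ a, e w s a a := by
  have hcomm := centre_mul_unit_comm_pair Φ f hfc hspan
  have ht : ∀ w s (a b c : Fin d), e w s a b * e w s b c = e w s a c := fun w s a b c ↦ by
    rw [hmul, if_pos ⟨rfl, rfl, rfl⟩]
  have hscalar : ∀ w s (k : K), ∃ c : ℂ, ∀ a, (f k).map (algebraMap ℚ ℂ) * e w s a a = c • e w s a a := by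
    intro w s k
    have hk := habs (f k) (hfE k)
    have hca : ∀ a, ∃ c : ℂ, (f k).map (algebraMap ℚ ℂ) * e w s a a = c • e w s a a := fun a ↦ by
      obtain ⟨c, hc⟩ := Submodule.mem_span_singleton.1
        (unit_mul_mul_unit_mem_span_singleton_pair hmul hk w s a a a a)
      exact ⟨c, by rw [hc, ← hcomm, Matrix.mul_assoc, ht]⟩
    choose c hc using hca
    refine ⟨c 0, fun a ↦ ?_⟩
    -- comparing on `e w s a 0`: `c a • e_a0 = k_ℂ e_aa e_a0 = k_ℂ e_a0 = e_a0 k_ℂ e_00 = c 0 • e_a0`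
    have h1 : (f k).map (algebraMap ℚ ℂ) * e w s a 0 = c a • e w s a 0 := by
      rw [← ht w s a a 0, ← Matrix.mul_assoc, hc a, Matrix.smul_mul]
    have h2 : (f k).map (algebraMap ℚ ℂ) * e w s a 0 = c 0 • e w s a 0 := by
      rw [hcomm, ← ht w s a 0 0, Matrix.mul_assoc, ← hcomm, hc 0, Matrix.mul_smul]
    by_cases hz : e w s a 0 = 0
    · have haa : e w s a a = 0 := by rw [← ht w s a 0 a, hz, Matrix.zero_mul]
      rw [haa, Matrix.mul_zero, smul_zero]
    · have hca0 : c a = c 0 := by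
        have h3 : (c a - c 0) • e w s a 0 = 0 := by rw [sub_smul, ← h1, h2, sub_self]
        rcases smul_eq_zero.1 h3 with h4 | h4
        · exact sub_eq_zero.1 h4
        · exact absurd h4 hz
      rw [hc a, hca0]
  choose c₀ hc₀ using hscalar
  refine ⟨fun p ↦ c₀ p.1 p.2, fun w s k ↦ ?_⟩
  rw [Finset.mul_sum, Finset.smul_sum]
  exact Finset.sum_congr rfl fun a _ ↦ hc₀ w s k a

/-- **THE PROJECTORS OF A COMPLETE FAMILY OF PAIRED `d × d` MATRIX UNITS ARE THE COMPLEX EMBEDDINGS OF A CENTRAL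
NUMBER FIELD WITH `[K:ℚ] = 2 · #W`** (the shape of Albert type IV: `E ⊗_ℚ ℂ = ∏_{w} (M_d(ℂ) × M_d(ℂ))` over the
`e₀ = #W` complex places `w` of the CM centre `K`, `[K:ℚ] = 2e₀`).  For a number field `f : K → Z(End_ℚ(X))` of central
endomorphisms (`ι ≠ ∅`, `d ≥ 1`) and paired systems `e w s a b` (`s ∈ {0,1}`, `a, b < d`) with the unit table,
`Σ_{w,s,a} e w s a a = 1`, lying in `End_ℚ(X) ⊗ ℂ` and spanning it: there is a BIJECTION `c : W × {0,1} ≃ Hom(K, ℂ)`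
with `k_ℂ · ε_{w,s} = (c (w,s))(k) · ε_{w,s}` for `ε_{w,s} = Σ_a e w s a a`, `ε_{w,s} V_ℂ = V_{c(w,s)}` («`V_σ`,
`σ₁, σ₂` the two extensions»), `rank ε_{w,s} · [K:ℚ] = #ι` (uniform) and `ε_{w,s} ≠ 0`.
[cite: Milne1999LefschetzClasses, §2 «Simple abelian variety of type IV» (p. 651: «`E ⊗_{F,σ} k^al ≈ M_d(k^al) × M_d(k^al)`», «`V_σ = V₁ ⊕ V₂`»), p. 646–647 and Prop. 2.1]
[cite: Lange2023AbelianVarietiesComplex, §2.6.1 proof of the Proposition (type IV: `End_ℚ(X) ⊗ ℝ ≃ ∏_{e₀} M_d(ℂ)`, `[K:ℚ] = 2e₀`)] -/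
theorem exists_equiv_embeddings_of_matrixUnitPairFamily_of_central [Nonempty ι] [NeZero d]
    (hfE : ∀ k, f k ∈ endAlgRat Φ) (hfc : ∀ k, ∀ A ∈ endAlgRat Φ, f k * A = A * f k)
    (hW : 2 * Fintype.card W = finrank ℚ K)
    (hmul : ∀ (w w' : W) (s s' : Fin 2) (a b c d' : Fin d),
      e w s a b * e w' s' c d' = if w = w' ∧ s = s' ∧ b = c then e w s a d' else 0)
    (hone : ∑ w, ∑ s, ∑ a, e w s a a = 1)
    (hspan : ∀ w s a b,
      e w s a b ∈ Submodule.span ℂ ((fun A : Matrix ι ι ℚ ↦ A.map (algebraMap ℚ ℂ)) '' (endAlgRat Φ : Set (Matrix ι ι ℚ))))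
    (habs : ∀ A ∈ endAlgRat Φ, A.map (algebraMap ℚ ℂ) ∈
      Submodule.span ℂ (Set.range fun p : W × Fin 2 × Fin d × Fin d ↦ e p.1 p.2.1 p.2.2.1 p.2.2.2)) :
    ∃ c : W × Fin 2 ≃ (K →+* ℂ),
      (∀ w s (k : K), (f k).map (algebraMap ℚ ℂ) * ∑ a, e w s a a = (c (w, s) k) • ∑ a, e w s a a) ∧
      (∀ w s, LinearMap.range (Matrix.toLin' (∑ a, e w s a a)) =
        ⨅ k : K, Module.End.eigenspace (Matrix.toLin' ((f k).map (algebraMap ℚ ℂ))) (c (w, s) k)) ∧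
      (∀ w s, (∑ a, e w s a a).rank * finrank ℚ K = Fintype.card ι) ∧
      (∀ w s, ∑ a, e w s a a ≠ 0) := by
  classical
  obtain ⟨c₀, hc₀⟩ := exists_centre_smul_pair Φ f hfE hfc hmul hspan habs
  have hcomm := centre_mul_unit_comm_pair Φ f hfc hspan
  have hone' : ∑ p : W × Fin 2, ∑ a, e p.1 p.2 a a = 1 := by
    rw [Fintype.sum_prod_type]
    exact hone
  have hcomm' : ∀ (k : K) (p : W × Fin 2), (f k).map (algebraMap ℚ ℂ) * ∑ a, e p.1 p.2 a a =
      (∑ a, e p.1 p.2 a a) * (f k).map (algebraMap ℚ ℂ) := fun k p ↦ by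
    rw [Finset.mul_sum, Finset.sum_mul]
    exact Finset.sum_congr rfl fun a _ ↦ hcomm k p.1 p.2 a a
  have hc₀' : ∀ (p : W × Fin 2) (k : K),
      (f k).map (algebraMap ℚ ℂ) * ∑ a, e p.1 p.2 a a = c₀ p k • ∑ a, e p.1 p.2 a a := fun p k ↦ hc₀ p.1 p.2 k
  have hW' : Fintype.card (W × Fin 2) = finrank ℚ K := by
    rw [Fintype.card_prod, Fintype.card_fin, mul_comm]
    exact hW
  obtain ⟨c, hc, hrange, hrank, hne⟩ :=
    exists_equiv_embeddings_of_centralIdempotents f (ε := fun p : W × Fin 2 ↦ ∑ a, e p.1 p.2 a a) hW' hone'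
      hcomm' hc₀'
  refine ⟨c, fun w s k ↦ ?_, fun w s ↦ hrange (w, s), fun w s ↦ hrank (w, s), fun w s ↦ hne (w, s)⟩
  rw [hc₀ w s k, hc (w, s)]

end CentreDictionaryPairs

/-! ## §4 Block sizes of paired frames are ranks -/

section PairFrameRank

variable {ι : Type*} [Fintype ι] [DecidableEq ι] {W : Type*} [Fintype W] [DecidableEq W]

omit [Fintype ι] [DecidableEq ι] [Fintype W] [DecidableEq W] in
/-- `Σ_a (E_{aa} ⊗ D) = 1 ⊗ D` after any relabelling (the diagonal units of `M_k` sum to `1`). [folklore] -/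
private theorem sum_submatrix_single_kronecker {k : ℕ} {T : Type*} (D : Matrix T T ℂ) (e₁ e₂ : ι → Fin k × T) :
    ∑ a : Fin k, (Matrix.single a a (1 : ℂ) ⊗ₖ D).submatrix e₁ e₂ =
      ((1 : Matrix (Fin k) (Fin k) ℂ) ⊗ₖ D).submatrix e₁ e₂ := by
  ext i j
  simp only [Matrix.sum_apply, Matrix.submatrix_apply, Matrix.kroneckerMap_apply, Matrix.single, Matrix.of_apply,
    Matrix.one_apply, ← Finset.sum_mul]
  congr 1
  by_cases h : (e₁ i).1 = (e₂ j).1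
  · rw [if_pos h, Finset.sum_eq_single (e₁ i).1 (fun a _ ha ↦ if_neg fun H ↦ ha H.1) fun hn ↦
      (hn (Finset.mem_univ _)).elim, if_pos ⟨rfl, h⟩]
  · rw [if_neg h]
    exact Finset.sum_eq_zero fun a _ ↦ if_neg fun H ↦ h (H.1.symm.trans H.2)

/-- **Block sizes are ranks, paired frames**: if `X_a · P = P · (E_{aa} ⊗ Π_{w,s})` (`a < d`) in a frame
`P ∈ GL_ι(ℂ)` relabelled by `eι : Fin d × Σ_w ({0,1} × Fin (m w)) ≃ ι` (`Π_{w,s}` the diagonal projector onto block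
`(w,s)`) — the frame clause of `ComplexTorusLefschetzGroupMatrixUnitPairFamilyConnected` for the corners
`X_a = e w s a a` — then `rank (Σ_a X_a) = d · m w`: the projector `ε_{w,s} = Σ_a e w s a a = P (1_d ⊗ Π_{w,s}) P⁻¹`
has rank `d · m_w` («`V_σ = V₁ ⊕ V₂`», `V₁ = V_{σ₁}` carrying `d` copies of the standard representation).
[cite: Milne1999LefschetzClasses, §2 «Simple abelian variety of type IV» (p. 651: «the direct sum of `d` copies of the standard representation of `GL_{g/(fd)}` and `d` copies of its contragredient»)] -/
theorem rank_sum_eq_of_mul_eq_mul_single_kronecker_submatrix {d : ℕ} {m : W → ℕ}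
    (eι : (Fin d × Σ w, Fin 2 × Fin (m w)) ≃ ι) {P : Matrix ι ι ℂ} {X : Fin d → Matrix ι ι ℂ} (hP : IsUnit P.det)
    (w : W) (s : Fin 2)
    (h : ∀ a, X a * P = P * (Matrix.single a a (1 : ℂ) ⊗ₖ Matrix.diagonal
        fun p : Σ w, Fin 2 × Fin (m w) ↦ if p.1 = w ∧ p.2.1 = s then (1 : ℂ) else 0).submatrix eι.symm eι.symm) :
    (∑ a, X a).rank = d * m w := by
  classical
  set Y : Matrix ι ι ℂ := ((1 : Matrix (Fin d) (Fin d) ℂ) ⊗ₖ Matrix.diagonal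
    fun p : Σ w, Fin 2 × Fin (m w) ↦ if p.1 = w ∧ p.2.1 = s then (1 : ℂ) else 0).submatrix eι.symm eι.symm with hY
  have hsum : (∑ a, X a) * P = P * Y := by
    rw [Finset.sum_mul, hY, ← sum_submatrix_single_kronecker, Finset.mul_sum]
    exact Finset.sum_congr rfl fun a _ ↦ h a
  have hX : ∑ a, X a = P * Y * P⁻¹ := by
    rw [← hsum, Matrix.mul_assoc, Matrix.mul_nonsing_inv _ hP, Matrix.mul_one]
  rw [hX, Matrix.rank_mul_eq_left_of_isUnit_det P⁻¹ (P * Y) (Matrix.isUnit_nonsing_inv_det P hP),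
    Matrix.rank_mul_eq_right_of_isUnit_det P Y hP, hY, Matrix.rank_submatrix, ← Matrix.diagonal_one,
    Matrix.diagonal_kronecker_diagonal, Matrix.rank_diagonal]
  -- count the non-zero diagonal entries: `q = (a, ⟨w, (s, x)⟩)`, `a : Fin d`, `x : Fin (m w)`
  have hpred : ∀ q : Fin d × Σ w, Fin 2 × Fin (m w),
      ((1 : ℂ) * (if q.2.1 = w ∧ q.2.2.1 = s then (1 : ℂ) else 0) ≠ 0) ↔ (q.2.1 = w ∧ q.2.2.1 = s) := by
    intro q
    by_cases hq : q.2.1 = w ∧ q.2.2.1 = s <;> simp [hq]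
  let eqv : {q : Fin d × Σ w, Fin 2 × Fin (m w) // q.2.1 = w ∧ q.2.2.1 = s} ≃ Fin d × Fin (m w) :=
    { toFun := fun q ↦ (q.1.1, Fin.cast (congrArg m q.2.1) q.1.2.2.2)
      invFun := fun y ↦ ⟨(y.1, ⟨w, (s, y.2)⟩), rfl, rfl⟩
      left_inv := by
        rintro ⟨⟨a, w', s', x⟩, hw', hs'⟩
        obtain rfl : w' = w := hw'
        obtain rfl : s' = s := hs'
        rfl
      right_inv := fun ⟨_, _⟩ ↦ rfl }
  refine (Fintype.card_congr ((Equiv.subtypeEquivRight hpred).trans eqv)).trans ?_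
  rw [Fintype.card_prod, Fintype.card_fin, Fintype.card_fin]

end PairFrameRank

end ComplexTorus

end Literature.Geometry.Kaehler
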